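/-
Origin: expansion seat `planner-pub-hodgecm-toy2-g2-0`, handover 2026-08-18 (`HOME/pub-hodgecm-toy2-g2/lean/Toy2g2/Cubic.lean`, md5 23b35ca9, 152 lines);
landed by the gen-6 packager in gate run 22 as `HodgeCM/Model/SexticCM/Cubic.lean` (verbatim).
-/
/-
Copyright: pub-hodgecm formalisation cell (harness21, 2026). New file (not vendored).
Origin: HOME/pub-hodgecm-toy2-g2/lean/Toy2g2/Cubic.lean (WIP module `Toy2g2.Cubic`; intended final place
`HodgeCM/Model/SexticCM/Cubic.lean` = module `HodgeCM.Model.SexticCM.Cubic`, CONTRIBUTING §3 L5) (seat planner-pub-hodgecm-toy2-g2-0,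
consistency seat 2 gen 2, part (6a)(ii): PerL's hypotheses are inhabited — the real cubic x^3-4x+1: roots alpha_k, beta_k = 2-alpha_k > 0, delta_k = i*sqrt(beta_k)).
-/
import Mathlib

open Polynomial IntermediateField NumberField

noncomputable section

namespace HodgeCM.SexticCM

/-! ## Layer 1: the cubic `x³ - 4x + 1` -/

/-- the real cubic function -/
def f3 (x : ℝ) : ℝ := x ^ 3 - 4 * x + 1

/-- (Ported verbatim from the HodgeCMPerL package; no docstring in the source.) -/
lemma f3_cont : Continuous f3 := by unfold f3; fun_prop

/-- (Ported verbatim from the HodgeCMPerL package; no docstring in the source.) -/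
lemma exists_root_Icc {a b : ℝ} (hab : a ≤ b) (ha : f3 a ≤ 0) (hb : 0 ≤ f3 b) :
    ∃ x ∈ Set.Icc a b, f3 x = 0 := by
  have := intermediate_value_Icc hab f3_cont.continuousOn
  exact this ⟨ha, hb⟩

/-- (Ported verbatim from the HodgeCMPerL package; no docstring in the source.) -/
lemma exists_root_Icc' {a b : ℝ} (hab : a ≤ b) (ha : 0 ≤ f3 a) (hb : f3 b ≤ 0) :
    ∃ x ∈ Set.Icc a b, f3 x = 0 := by
  have := intermediate_value_Icc' hab f3_cont.continuousOn
  exact this ⟨hb, ha⟩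

/-- three real roots, in `[-3,-2]`, `[0,1]`, `[1.5,2]` -/
lemma exists_roots : ∃ a₁ a₂ a₃ : ℝ, f3 a₁ = 0 ∧ f3 a₂ = 0 ∧ f3 a₃ = 0 ∧
    a₁ ≤ -2 ∧ 0 ≤ a₂ ∧ a₂ ≤ 1 ∧ 3/2 ≤ a₃ ∧ a₃ < 2 := by
  obtain ⟨a₁, h₁, e₁⟩ := exists_root_Icc (a := -3) (b := -2) (by norm_num) (by norm_num [f3]) (by norm_num [f3])
  obtain ⟨a₂, h₂, e₂⟩ := exists_root_Icc' (a := 0) (b := 1) (by norm_num) (by norm_num [f3]) (by norm_num [f3])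
  obtain ⟨a₃, h₃, e₃⟩ := exists_root_Icc (a := 3/2) (b := 2) (by norm_num) (by norm_num [f3]) (by norm_num [f3])
  refine ⟨a₁, a₂, a₃, e₁, e₂, e₃, h₁.2, h₂.1, h₂.2, h₃.1, lt_of_le_of_ne h₃.2 ?_⟩
  rintro rfl; norm_num [f3] at e₃

/-- The three real roots `α₀ < α₁ < α₂` of `x³ - 4x + 1` (chosen). -/
def α : Fin 3 → ℝ := fun k =>
  match k with
  | 0 => exists_roots.choose
  | 1 => exists_roots.choose_spec.choose
  | 2 => exists_roots.choose_spec.choose_spec.choose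

/-- (Ported verbatim from the HodgeCMPerL package; no docstring in the source.) -/
lemma α_spec : f3 (α 0) = 0 ∧ f3 (α 1) = 0 ∧ f3 (α 2) = 0 ∧
    α 0 ≤ -2 ∧ 0 ≤ α 1 ∧ α 1 ≤ 1 ∧ 3/2 ≤ α 2 ∧ α 2 < 2 :=
  exists_roots.choose_spec.choose_spec.choose_spec

/-- (Ported verbatim from the HodgeCMPerL package; no docstring in the source.) -/
lemma f3_α (k : Fin 3) : α k ^ 3 - 4 * α k + 1 = 0 := by
  fin_cases k
  · exact α_spec.1
  · exact α_spec.2.1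
  · exact α_spec.2.2.1

/-- (Ported verbatim from the HodgeCMPerL package; no docstring in the source.) -/
lemma α_lt_two (k : Fin 3) : α k < 2 := by
  have h := α_spec
  fin_cases k <;> simp <;> linarith

/-- (Ported verbatim from the HodgeCMPerL package; no docstring in the source.) -/
lemma α_injective : Function.Injective α := by
  have h := α_spec
  intro i j hij
  fin_cases i <;> fin_cases j <;> simp_all <;> linarith

/-- `β_k = 2 - α_k > 0` -/
def β (k : Fin 3) : ℝ := 2 - α k

/-- (Ported verbatim from the HodgeCMPerL package; no docstring in the source.) -/
lemma β_pos (k : Fin 3) : 0 < β k := by unfold β; linarith [α_lt_two k]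

/-- (Ported verbatim from the HodgeCMPerL package; no docstring in the source.) -/
lemma β_injective : Function.Injective β := fun i j h => α_injective (by unfold β at h; linarith)

/-! Vieta -/
/-- (Ported verbatim from the HodgeCMPerL package; no docstring in the source.) -/
lemma vieta : α 0 + α 1 + α 2 = 0 ∧ α 0 * α 1 + α 0 * α 2 + α 1 * α 2 = -4 ∧ α 0 * α 1 * α 2 = -1 := by
  have h0 := f3_α 0; have h1 := f3_α 1; have h2 := f3_α 2
  have n01 : α 0 ≠ α 1 := fun h => by have := α_injective h; simp at this
  have n02 : α 0 ≠ α 2 := fun h => by have := α_injective h; simp at this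
  have n12 : α 1 ≠ α 2 := fun h => by have := α_injective h; simp at this
  -- (a-b)(a²+ab+b²-4) = 0
  have q01 : α 0 ^ 2 + α 0 * α 1 + α 1 ^ 2 = 4 := by
    have : (α 0 - α 1) * (α 0 ^ 2 + α 0 * α 1 + α 1 ^ 2 - 4) = 0 := by linear_combination h0 - h1
    rcases mul_eq_zero.mp this with h | h
    · exact absurd (sub_eq_zero.mp h) n01
    · linarith
  have q02 : α 0 ^ 2 + α 0 * α 2 + α 2 ^ 2 = 4 := by
    have : (α 0 - α 2) * (α 0 ^ 2 + α 0 * α 2 + α 2 ^ 2 - 4) = 0 := by linear_combination h0 - h2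
    rcases mul_eq_zero.mp this with h | h
    · exact absurd (sub_eq_zero.mp h) n02
    · linarith
  have s : α 0 + α 1 + α 2 = 0 := by
    have : (α 1 - α 2) * (α 0 + α 1 + α 2) = 0 := by linear_combination q01 - q02
    rcases mul_eq_zero.mp this with h | h
    · exact absurd (sub_eq_zero.mp h) n12
    · exact h
  refine ⟨s, ?_, ?_⟩
  · have : α 2 = -(α 0 + α 1) := by linarith
    rw [this]; nlinarith [q01]
  · have e2 : α 0 * α 1 + α 0 * α 2 + α 1 * α 2 = -4 := by
      have : α 2 = -(α 0 + α 1) := by linarith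
      rw [this]; nlinarith [q01]
    -- x³ - e₁x² + e₂x - e₃ at x = α 0
    linear_combination h0 - (α 0) ^ 2 * s + (α 0) * e2

/-! ## Layer 2: `δ_k = i √β_k` -/

/-- `δ_k = i·√(2 - α_k) ∈ ℂ` -/
def δ (k : Fin 3) : ℂ := Complex.I * (Real.sqrt (β k) : ℂ)

/-- (Ported verbatim from the HodgeCMPerL package; no docstring in the source.) -/
lemma δ_sq (k : Fin 3) : δ k ^ 2 = ((α k : ℝ) : ℂ) - 2 := by
  unfold δ
  have hb : ((Real.sqrt (β k) : ℝ) : ℂ) ^ 2 = (β k : ℂ) := by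
    rw [← Complex.ofReal_pow, Real.sq_sqrt (β_pos k).le]
  rw [mul_pow, Complex.I_sq, hb]; unfold β; push_cast; ring

/-- (Ported verbatim from the HodgeCMPerL package; no docstring in the source.) -/
lemma δ_ne_zero (k : Fin 3) : δ k ≠ 0 := by
  unfold δ
  refine mul_ne_zero Complex.I_ne_zero ?_
  exact_mod_cast (Real.sqrt_pos.mpr (β_pos k)).ne'

/-- (Ported verbatim from the HodgeCMPerL package; no docstring in the source.) -/
lemma conj_δ (k : Fin 3) : (starRingEnd ℂ) (δ k) = -δ k := by
  unfold δ; simp [Complex.conj_ofReal]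

/-- (Ported verbatim from the HodgeCMPerL package; no docstring in the source.) -/
lemma δ_im_pos (k : Fin 3) : 0 < (δ k).im := by
  unfold δ; simp [Real.sqrt_pos.mpr (β_pos k)]

/-- (Ported verbatim from the HodgeCMPerL package; no docstring in the source.) -/
lemma δ_injective : Function.Injective δ := by
  intro i j h
  have := congrArg Complex.im h
  unfold δ at this; simp at this
  exact β_injective ((Real.sqrt_inj (β_pos i).le (β_pos j).le).mp this)

/-- (Ported verbatim from the HodgeCMPerL package; no docstring in the source.) -/
lemma δ_ne_neg (i j : Fin 3) : δ i ≠ -δ j := by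
  intro h; have := congrArg Complex.im h
  simp at this; linarith [δ_im_pos i, δ_im_pos j]

/-- `±1` from a Boolean sign -/
def sgn (b : Bool) : ℂ := if b then 1 else -1

/-- (Ported verbatim from the HodgeCMPerL package; no docstring in the source.) -/
@[simp] lemma sgn_true : sgn true = 1 := rfl
/-- (Ported verbatim from the HodgeCMPerL package; no docstring in the source.) -/
@[simp] lemma sgn_false : sgn false = -1 := rfl

/-- (Ported verbatim from the HodgeCMPerL package; no docstring in the source.) -/
lemma sgn_not (b : Bool) : sgn (!b) = -sgn b := by cases b <;> simp

/-- (Ported verbatim from the HodgeCMPerL package; no docstring in the source.) -/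
lemma sgn_mul_δ_inj {b b' : Bool} {m j : Fin 3} (h : sgn b * δ m = sgn b' * δ j) : b = b' ∧ m = j := by
  cases b <;> cases b' <;> simp at h
  · exact ⟨rfl, δ_injective h⟩
  · exact absurd h.symm (δ_ne_neg j m)
  · exact absurd h (δ_ne_neg m j)
  · exact ⟨rfl, δ_injective h⟩

end HodgeCM.SexticCM
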